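import Summits.Ventures.AbcSig.Conjectures.LevelRaising32L2Instances
import Summits.Ventures.AbcSig.Levels.N1504
import Summits.Ventures.AbcSig.Levels.N2272
import Summits.Ventures.AbcSig.Levels.N2528
import Summits.Ventures.AbcSig.Levels.N3104
import Summits.Ventures.AbcSig.Levels.N4384
import Summits.Ventures.AbcSig.Levels.N4832
import Summits.Ventures.AbcSig.Levels.N6368
import Summits.Ventures.AbcSig.Levels.N7136

/-!
# Venture AbcSig — `CONJ_LR32_L2` slices at the CENSUS levels `2⁵ℓ` settled by the tree's NORM-FORM coarse certificates (part 3)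

HONEST FRAMING. Support file of the computation cell `pub-abcsig`, companion of `Conjectures/LevelRaising32L2Instances.lean` (p495825)
and `…Census.lean` / `…Census2.lean` (p500505 / p501101). `CONJ_LR32_L2` (p490111) is a CONJECTURE over the abstract `NewformModel`;
nothing here proves it or adds evidence for its content beyond what the level files already certify. GENERATED MECHANICALLY
(HOME/plean/g15/gen15/make_census_slices_cp.py) from the tree's norm-form level files `Levels/N<32ℓ>.lean` (charpoly certificates
`cp_N_i_check : cpCheck … = true`, [BS04, Prop. 4.3] norm form up to sign): a level qualifies iff every certificate base prime `≥ 17`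
lies in Ribet's level-raising set `R₃₂(ℓ)` (excluded by the slice's hypothesis `¬ LevelRaise a32 ℓ n`, `decide` in the kernel). Each
slice is proved from the TWO COMPUTED hypotheses of its level file — `DataComplete` (the orbit list is complete) and `RefinesCPSymAll`
(the listed characteristic polynomials, up to sign) — and NO cited package: the kill argument is carried out at the `ArisesMod` level
(`NewformModel.not_arisesMod_of_cpKills_sym`, `not_arisesMod_of_cpCheck_lr`), so, unlike the rows' `ExcludesStd` route, `BS04Package` is not needed. Numbers: 8 levels,
ℓ ∈ {47, 71, 79, 97, 137, 151, 199, 223}; VACUOUS (no base prime `≥ 17`) at 5 (ℓ ∈ {47, 71, 79, 199, 223}); via the LEVEL-RAISING clause at 3 ((97; 29); (137; 29); (151; 19)). WHAT THIS IS NOT: the Kraus-table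
part of the premise and the `CongruentToFrey` conclusion stay idle in every proof; levels whose base primes `≥ 17` lie outside `R₃₂(ℓ)`
(closed in the rows of record by Kraus/M4 or other modules — e.g. `ℓ = 103, 127, 373, 389`; at `(313; 23)` the a0 = `E₁` classes are
OPEN in the certificates of record (kmax 40) — see HOME/STRUCTURE.md v3.18 E-LR32-313) are absent; nothing here is a claim on ABC or any summit.

References: [BS04] M. A. Bennett, C. M. Skinner, Canad. J. Math. 56 (2004) 23–54, Lemma 4.2, Prop. 4.3; [Rib90b] K. Ribet, Progr. Math. 81
(1990) 259–271, Thm 1.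
-/

namespace Summit.Ventures.AbcSig.Conjectures

open Summit.Ventures.AbcSig

/-- **[BS04, Prop. 4.3] norm form, up to sign, at the `ArisesMod` level (no cited package).** If the newforms matching `o` have the
listed characteristic polynomials up to sign (`RefinesCPSym`, COMPUTED) and `cpKills cp bs04Allowed n N`, then NO newform matching `o`
passes the coarse [BS04, Lemma 4.2] sets modulo a prime above `n`: from `ψ(c_ℓ) = t` with `t` allowed and `P_ℓ(±c_ℓ) = 0` one gets
`n ∣ P_ℓ(±t)`, contradicting the kill test (the proof of `NewformModel.excludesStd_of_cpKills_sym` from the point where `BS04Package`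
has delivered `ψ`; here `ψ` is the hypothesis). -/
theorem _root_.Summit.Ventures.AbcSig.NewformModel.not_arisesMod_of_cpKills_sym (M : NewformModel) {N : ℕ} (o : OrbitData)
    (cp : List CPEntry) (hRef : M.RefinesCPSym N o cp) (n : ℕ) (hkill : cpKills cp bs04Allowed n N = true)
    (f : M.Form N) (hfo : M.Matches f o) : ¬ M.ArisesMod f n bs04Allowed := by
  rintro ⟨k, hk, hchar, ψ, hψ⟩
  simp only [cpKills, List.any_eq_true, Bool.and_eq_true, decide_eq_true_eq, List.all_eq_true] at hkill
  obtain ⟨e, he, ⟨⟨⟨⟨hep, he2⟩, hen⟩, heN⟩, hall⟩⟩ := hkill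
  obtain ⟨t, ht, hψt⟩ := hψ e.ell hep he2 hen heN
  rcases hRef f hfo e he with hroot | hroot
  · have h0 : ((hornerZ e.P t : ℤ) : k) = 0 := by
      rw [← map_evalL_eq_hornerZ ψ (M.eig N f e.ell) t hψt e.P, hroot, map_zero]
    have hdvd : (n : ℤ) ∣ hornerZ e.P t := (CharP.intCast_eq_zero_iff k n _).mp h0
    have hne := hall t ht
    simp only [bne_iff_ne, ne_eq] at hne
    exact hne (Int.emod_eq_zero_of_dvd hdvd)
  · have hψt' : ψ (-M.eig N f e.ell) = ((-t : ℤ) : k) := by rw [map_neg, hψt, Int.cast_neg]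
    have h0 : ((hornerZ e.P (-t) : ℤ) : k) = 0 := by
      rw [← map_evalL_eq_hornerZ ψ (-M.eig N f e.ell) (-t) hψt' e.P, hroot, map_zero]
    have hdvd : (n : ℤ) ∣ hornerZ e.P (-t) := (CharP.intCast_eq_zero_iff k n _).mp h0
    have hne := hall (-t) (neg_mem_bs04Allowed ht)
    simp only [bne_iff_ne, ne_eq] at hne
    exact hne (Int.emod_eq_zero_of_dvd hdvd)

/-- All-exponent form: a checked norm-form certificate `cpCheck cp bs04Allowed N fac` (prime bases `fac`) forbids the coarse premise
for every newform matching `o` at every prime `n` off the base list, modulo the COMPUTED `RefinesCPSym` only. -/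
theorem _root_.Summit.Ventures.AbcSig.NewformModel.not_arisesMod_of_cpCheck_sym (M : NewformModel) {N : ℕ} (o : OrbitData)
    (cp : List CPEntry) (fac : List (ℕ × ℕ)) (h : cpCheck cp bs04Allowed N fac = true) (hprimes : ∀ pe ∈ fac, pe.1.Prime)
    (hRef : M.RefinesCPSym N o cp) (n : ℕ) (hn : n.Prime) (hmem : n ∉ fac.map Prod.fst) (f : M.Form N) (hfo : M.Matches f o) :
    ¬ M.ArisesMod f n bs04Allowed :=
  M.not_arisesMod_of_cpKills_sym o cp hRef n (cpKills_of_cpCheck cp bs04Allowed N fac h hprimes n hn hmem) f hfo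

/-- A slice holds as soon as NO newform of level `2⁵ℓ` passes the coarse sets modulo a prime above any `n ≥ 17`, `n ≠ ℓ`, outside
`R₃₂(ℓ)` (the slice premise refines the coarse premise, `arisesMod_bs04_of_lr32ClassAllowed`). -/
theorem CONJ_LR32_L2At_of_not_arisesMod (M : NewformModel) {ℓ : ℕ} (hℓ : ℓ.Prime)
    (h : ∀ n : ℕ, n.Prime → 17 ≤ n → n ≠ ℓ → ¬ LevelRaise a32 ℓ n → ∀ f : M.Form (2 ^ 5 * ℓ), ¬ M.ArisesMod f n bs04Allowed) :
    CONJ_LR32_L2At M ℓ :=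
  fun n hn h17 hnℓ hLR f _ hκ hA => absurd (arisesMod_bs04_of_lr32ClassAllowed M hℓ (by omega) f hκ hA) (h n hn h17 hnℓ hLR f)

/-- Certificate bases admissible for the slice at `ℓ`, given the VALUE `a = a_ℓ(32a)`: every base prime is `< 17`, equal to `ℓ`, or a
level-raising prime of `32a` at `ℓ` (`p ∣ (ℓ + 1)² − a²`) — exactly the exponents the slice `CONJ_LR32_L2At M ℓ` does not quantify over.
(The value is supplied per level by one kernel evaluation `a32 ℓ = a`, so the point count is done once per level, not once per orbit.) -/
def lr32BasesOK (ℓ : ℕ) (a : ℤ) (fac : List (ℕ × ℕ)) : Bool :=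
  fac.all fun pe => decide (pe.1 < 17) || decide (pe.1 = ℓ) || decide ((pe.1 : ℤ) ∣ ((ℓ : ℤ) + 1) ^ 2 - a ^ 2)

/-- An exponent in the slice's range is off every admissible base list. -/
theorem not_mem_of_lr32BasesOK {ℓ n : ℕ} {a : ℤ} {fac : List (ℕ × ℕ)} (ha : a32 ℓ = a) (hok : lr32BasesOK ℓ a fac = true)
    (h17 : 17 ≤ n) (hnℓ : n ≠ ℓ) (hLR : ¬ LevelRaise a32 ℓ n) : n ∉ fac.map Prod.fst := by
  intro hmem
  obtain ⟨pe, hpe, hpn⟩ := List.mem_map.mp hmem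
  have h := List.all_eq_true.mp hok pe hpe
  simp only [Bool.or_eq_true, decide_eq_true_eq] at h
  rcases h with (h | h) | h
  · omega
  · exact hnℓ (hpn ▸ h)
  · apply hLR
    unfold LevelRaise
    rw [ha, ← hpn]
    exact h

/-- **Per-orbit step of the norm-form slices.** A checked norm-form certificate with admissible bases forbids the coarse premise for
every newform matching the orbit at every exponent of the slice's range (computed hypothesis `RefinesCPSym` only). -/
theorem not_arisesMod_of_cpCheck_lr (M : NewformModel) {N ℓ : ℕ} {a : ℤ} (ha : a32 ℓ = a) (o : OrbitData) (cp : List CPEntry)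
    (fac : List (ℕ × ℕ)) (h : cpCheck cp bs04Allowed N fac = true) (hprimes : ∀ pe ∈ fac, pe.1.Prime) (hRef : M.RefinesCPSym N o cp)
    {n : ℕ} (hn : n.Prime) (h17 : 17 ≤ n) (hnℓ : n ≠ ℓ) (hLR : ¬ LevelRaise a32 ℓ n) (hok : lr32BasesOK ℓ a fac = true)
    (f : M.Form N) (hfo : M.Matches f o) : ¬ M.ArisesMod f n bs04Allowed :=
  M.not_arisesMod_of_cpCheck_sym o cp fac h hprimes hRef n hn (not_mem_of_lr32BasesOK ha hok h17 hnℓ hLR) f hfo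

/-- **`CONJ_LR32_L2` at `ℓ = 47` (level `1504 = 2⁵·47`) holds in every model whose level-1504 newforms are the 8 listed orbits of `Levels/N1504.lean`
with the listed characteristic polynomials up to sign** (computed hypotheses `DataComplete`, `RefinesCPSymAll`; vacuous: every certificate base prime is `< 17`). -/
theorem CONJ_LR32_L2At_47 (M : NewformModel) (hD : M.DataComplete 1504 level1504Orbits) (hCP : M.RefinesCPSymAll 1504 level1504CP) :
    CONJ_LR32_L2At M 47 :=
  CONJ_LR32_L2At_of_not_arisesMod M (by norm_num) fun n hn h17 hnℓ hLR f hA => by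
    obtain ⟨o, ho, hfo⟩ := hD f
    simp only [level1504Orbits, List.mem_cons, List.not_mem_nil, or_false] at ho
    rcases ho with rfl | rfl | rfl | rfl | rfl | rfl | rfl | rfl
    · exact not_arisesMod_of_cpCheck_lr M rfl _ _ _ cp_1504_1_check (by norm_num) (hCP.of_mem (by simp [level1504CP])) hn h17 hnℓ hLR
        (by decide +kernel) f hfo hA
    · exact not_arisesMod_of_cpCheck_lr M rfl _ _ _ cp_1504_2_check (by norm_num) (hCP.of_mem (by simp [level1504CP])) hn h17 hnℓ hLR
        (by decide +kernel) f hfo hA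
    · exact not_arisesMod_of_cpCheck_lr M rfl _ _ _ cp_1504_3_check (by norm_num) (hCP.of_mem (by simp [level1504CP])) hn h17 hnℓ hLR
        (by decide +kernel) f hfo hA
    · exact not_arisesMod_of_cpCheck_lr M rfl _ _ _ cp_1504_4_check (by norm_num) (hCP.of_mem (by simp [level1504CP])) hn h17 hnℓ hLR
        (by decide +kernel) f hfo hA
    · exact not_arisesMod_of_cpCheck_lr M rfl _ _ _ cp_1504_5_check (by norm_num) (hCP.of_mem (by simp [level1504CP])) hn h17 hnℓ hLR
        (by decide +kernel) f hfo hA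
    · exact not_arisesMod_of_cpCheck_lr M rfl _ _ _ cp_1504_6_check (by norm_num) (hCP.of_mem (by simp [level1504CP])) hn h17 hnℓ hLR
        (by decide +kernel) f hfo hA
    · exact not_arisesMod_of_cpCheck_lr M rfl _ _ _ cp_1504_7_check (by norm_num) (hCP.of_mem (by simp [level1504CP])) hn h17 hnℓ hLR
        (by decide +kernel) f hfo hA
    · exact not_arisesMod_of_cpCheck_lr M rfl _ _ _ cp_1504_8_check (by norm_num) (hCP.of_mem (by simp [level1504CP])) hn h17 hnℓ hLR
        (by decide +kernel) f hfo hA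

/-- **`CONJ_LR32_L2` at `ℓ = 71` (level `2272 = 2⁵·71`) holds in every model whose level-2272 newforms are the 12 listed orbits of `Levels/N2272.lean`
with the listed characteristic polynomials up to sign** (computed hypotheses `DataComplete`, `RefinesCPSymAll`; vacuous: every certificate base prime is `< 17`). -/
theorem CONJ_LR32_L2At_71 (M : NewformModel) (hD : M.DataComplete 2272 level2272Orbits) (hCP : M.RefinesCPSymAll 2272 level2272CP) :
    CONJ_LR32_L2At M 71 :=
  CONJ_LR32_L2At_of_not_arisesMod M (by norm_num) fun n hn h17 hnℓ hLR f hA => by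
    obtain ⟨o, ho, hfo⟩ := hD f
    simp only [level2272Orbits, List.mem_cons, List.not_mem_nil, or_false] at ho
    rcases ho with rfl | rfl | rfl | rfl | rfl | rfl | rfl | rfl | rfl | rfl | rfl | rfl
    · exact not_arisesMod_of_cpCheck_lr M rfl _ _ _ cp_2272_1_check (by norm_num) (hCP.of_mem (by simp [level2272CP])) hn h17 hnℓ hLR
        (by decide +kernel) f hfo hA
    · exact not_arisesMod_of_cpCheck_lr M rfl _ _ _ cp_2272_2_check (by norm_num) (hCP.of_mem (by simp [level2272CP])) hn h17 hnℓ hLR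
        (by decide +kernel) f hfo hA
    · exact not_arisesMod_of_cpCheck_lr M rfl _ _ _ cp_2272_3_check (by norm_num) (hCP.of_mem (by simp [level2272CP])) hn h17 hnℓ hLR
        (by decide +kernel) f hfo hA
    · exact not_arisesMod_of_cpCheck_lr M rfl _ _ _ cp_2272_4_check (by norm_num) (hCP.of_mem (by simp [level2272CP])) hn h17 hnℓ hLR
        (by decide +kernel) f hfo hA
    · exact not_arisesMod_of_cpCheck_lr M rfl _ _ _ cp_2272_5_check (by norm_num) (hCP.of_mem (by simp [level2272CP])) hn h17 hnℓ hLR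
        (by decide +kernel) f hfo hA
    · exact not_arisesMod_of_cpCheck_lr M rfl _ _ _ cp_2272_6_check (by norm_num) (hCP.of_mem (by simp [level2272CP])) hn h17 hnℓ hLR
        (by decide +kernel) f hfo hA
    · exact not_arisesMod_of_cpCheck_lr M rfl _ _ _ cp_2272_7_check (by norm_num) (hCP.of_mem (by simp [level2272CP])) hn h17 hnℓ hLR
        (by decide +kernel) f hfo hA
    · exact not_arisesMod_of_cpCheck_lr M rfl _ _ _ cp_2272_8_check (by norm_num) (hCP.of_mem (by simp [level2272CP])) hn h17 hnℓ hLR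
        (by decide +kernel) f hfo hA
    · exact not_arisesMod_of_cpCheck_lr M rfl _ _ _ cp_2272_9_check (by norm_num) (hCP.of_mem (by simp [level2272CP])) hn h17 hnℓ hLR
        (by decide +kernel) f hfo hA
    · exact not_arisesMod_of_cpCheck_lr M rfl _ _ _ cp_2272_10_check (by norm_num) (hCP.of_mem (by simp [level2272CP])) hn h17 hnℓ hLR
        (by decide +kernel) f hfo hA
    · exact not_arisesMod_of_cpCheck_lr M rfl _ _ _ cp_2272_11_check (by norm_num) (hCP.of_mem (by simp [level2272CP])) hn h17 hnℓ hLR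
        (by decide +kernel) f hfo hA
    · exact not_arisesMod_of_cpCheck_lr M rfl _ _ _ cp_2272_12_check (by norm_num) (hCP.of_mem (by simp [level2272CP])) hn h17 hnℓ hLR
        (by decide +kernel) f hfo hA

/-- **`CONJ_LR32_L2` at `ℓ = 79` (level `2528 = 2⁵·79`) holds in every model whose level-2528 newforms are the 14 listed orbits of `Levels/N2528.lean`
with the listed characteristic polynomials up to sign** (computed hypotheses `DataComplete`, `RefinesCPSymAll`; vacuous: every certificate base prime is `< 17`). -/
theorem CONJ_LR32_L2At_79 (M : NewformModel) (hD : M.DataComplete 2528 level2528Orbits) (hCP : M.RefinesCPSymAll 2528 level2528CP) :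
    CONJ_LR32_L2At M 79 :=
  CONJ_LR32_L2At_of_not_arisesMod M (by norm_num) fun n hn h17 hnℓ hLR f hA => by
    obtain ⟨o, ho, hfo⟩ := hD f
    simp only [level2528Orbits, List.mem_cons, List.not_mem_nil, or_false] at ho
    rcases ho with rfl | rfl | rfl | rfl | rfl | rfl | rfl | rfl | rfl | rfl | rfl | rfl | rfl | rfl
    · exact not_arisesMod_of_cpCheck_lr M rfl _ _ _ cp_2528_1_check (by norm_num) (hCP.of_mem (by simp [level2528CP])) hn h17 hnℓ hLR
        (by decide +kernel) f hfo hA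
    · exact not_arisesMod_of_cpCheck_lr M rfl _ _ _ cp_2528_2_check (by norm_num) (hCP.of_mem (by simp [level2528CP])) hn h17 hnℓ hLR
        (by decide +kernel) f hfo hA
    · exact not_arisesMod_of_cpCheck_lr M rfl _ _ _ cp_2528_3_check (by norm_num) (hCP.of_mem (by simp [level2528CP])) hn h17 hnℓ hLR
        (by decide +kernel) f hfo hA
    · exact not_arisesMod_of_cpCheck_lr M rfl _ _ _ cp_2528_4_check (by norm_num) (hCP.of_mem (by simp [level2528CP])) hn h17 hnℓ hLR
        (by decide +kernel) f hfo hA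
    · exact not_arisesMod_of_cpCheck_lr M rfl _ _ _ cp_2528_5_check (by norm_num) (hCP.of_mem (by simp [level2528CP])) hn h17 hnℓ hLR
        (by decide +kernel) f hfo hA
    · exact not_arisesMod_of_cpCheck_lr M rfl _ _ _ cp_2528_6_check (by norm_num) (hCP.of_mem (by simp [level2528CP])) hn h17 hnℓ hLR
        (by decide +kernel) f hfo hA
    · exact not_arisesMod_of_cpCheck_lr M rfl _ _ _ cp_2528_7_check (by norm_num) (hCP.of_mem (by simp [level2528CP])) hn h17 hnℓ hLR
        (by decide +kernel) f hfo hA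
    · exact not_arisesMod_of_cpCheck_lr M rfl _ _ _ cp_2528_8_check (by norm_num) (hCP.of_mem (by simp [level2528CP])) hn h17 hnℓ hLR
        (by decide +kernel) f hfo hA
    · exact not_arisesMod_of_cpCheck_lr M rfl _ _ _ cp_2528_9_check (by norm_num) (hCP.of_mem (by simp [level2528CP])) hn h17 hnℓ hLR
        (by decide +kernel) f hfo hA
    · exact not_arisesMod_of_cpCheck_lr M rfl _ _ _ cp_2528_10_check (by norm_num) (hCP.of_mem (by simp [level2528CP])) hn h17 hnℓ hLR
        (by decide +kernel) f hfo hA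
    · exact not_arisesMod_of_cpCheck_lr M rfl _ _ _ cp_2528_11_check (by norm_num) (hCP.of_mem (by simp [level2528CP])) hn h17 hnℓ hLR
        (by decide +kernel) f hfo hA
    · exact not_arisesMod_of_cpCheck_lr M rfl _ _ _ cp_2528_12_check (by norm_num) (hCP.of_mem (by simp [level2528CP])) hn h17 hnℓ hLR
        (by decide +kernel) f hfo hA
    · exact not_arisesMod_of_cpCheck_lr M rfl _ _ _ cp_2528_13_check (by norm_num) (hCP.of_mem (by simp [level2528CP])) hn h17 hnℓ hLR
        (by decide +kernel) f hfo hA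
    · exact not_arisesMod_of_cpCheck_lr M rfl _ _ _ cp_2528_14_check (by norm_num) (hCP.of_mem (by simp [level2528CP])) hn h17 hnℓ hLR
        (by decide +kernel) f hfo hA

/-- `a_{97}(32a) = 18` (naive point count on `y² = x³ − x`, the tree's `a32`; evaluated ONCE here so that the slice below does not
recompute it per orbit). -/
theorem a32_val_97 : a32 97 = 18 := by decide +kernel

/-- **`CONJ_LR32_L2` at `ℓ = 97` (level `3104 = 2⁵·97`) holds in every model whose level-3104 newforms are the 9 listed orbits of `Levels/N3104.lean`
with the listed characteristic polynomials up to sign** (computed hypotheses `DataComplete`, `RefinesCPSymAll`; base primes `≥ 17`: [29] ⊆ `R₃₂(97)` = [2, 5, 29] (level raising, excluded by the slice hypothesis; `decide`)). -/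
theorem CONJ_LR32_L2At_97 (M : NewformModel) (hD : M.DataComplete 3104 level3104Orbits) (hCP : M.RefinesCPSymAll 3104 level3104CP) :
    CONJ_LR32_L2At M 97 :=
  CONJ_LR32_L2At_of_not_arisesMod M (by norm_num) fun n hn h17 hnℓ hLR f hA => by
    obtain ⟨o, ho, hfo⟩ := hD f
    simp only [level3104Orbits, List.mem_cons, List.not_mem_nil, or_false] at ho
    rcases ho with rfl | rfl | rfl | rfl | rfl | rfl | rfl | rfl | rfl
    · exact not_arisesMod_of_cpCheck_lr M a32_val_97 _ _ _ cp_3104_1_check (by norm_num) (hCP.of_mem (by simp [level3104CP])) hn h17 hnℓ hLR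
        (by decide +kernel) f hfo hA
    · exact not_arisesMod_of_cpCheck_lr M a32_val_97 _ _ _ cp_3104_2_check (by norm_num) (hCP.of_mem (by simp [level3104CP])) hn h17 hnℓ hLR
        (by decide +kernel) f hfo hA
    · exact not_arisesMod_of_cpCheck_lr M a32_val_97 _ _ _ cp_3104_3_check (by norm_num) (hCP.of_mem (by simp [level3104CP])) hn h17 hnℓ hLR
        (by decide +kernel) f hfo hA
    · exact not_arisesMod_of_cpCheck_lr M a32_val_97 _ _ _ cp_3104_4_check (by norm_num) (hCP.of_mem (by simp [level3104CP])) hn h17 hnℓ hLR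
        (by decide +kernel) f hfo hA
    · exact not_arisesMod_of_cpCheck_lr M a32_val_97 _ _ _ cp_3104_5_check (by norm_num) (hCP.of_mem (by simp [level3104CP])) hn h17 hnℓ hLR
        (by decide +kernel) f hfo hA
    · exact not_arisesMod_of_cpCheck_lr M a32_val_97 _ _ _ cp_3104_6_check (by norm_num) (hCP.of_mem (by simp [level3104CP])) hn h17 hnℓ hLR
        (by decide +kernel) f hfo hA
    · exact not_arisesMod_of_cpCheck_lr M a32_val_97 _ _ _ cp_3104_7_check (by norm_num) (hCP.of_mem (by simp [level3104CP])) hn h17 hnℓ hLR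
        (by decide +kernel) f hfo hA
    · exact not_arisesMod_of_cpCheck_lr M a32_val_97 _ _ _ cp_3104_8_check (by norm_num) (hCP.of_mem (by simp [level3104CP])) hn h17 hnℓ hLR
        (by decide +kernel) f hfo hA
    · exact not_arisesMod_of_cpCheck_lr M a32_val_97 _ _ _ cp_3104_9_check (by norm_num) (hCP.of_mem (by simp [level3104CP])) hn h17 hnℓ hLR
        (by decide +kernel) f hfo hA

/-- `a_{137}(32a) = -22` (naive point count on `y² = x³ − x`, the tree's `a32`; evaluated ONCE here so that the slice below does not
recompute it per orbit). -/
theorem a32_val_137 : a32 137 = -22 := by decide +kernel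

/-- **`CONJ_LR32_L2` at `ℓ = 137` (level `4384 = 2⁵·137`) holds in every model whose level-4384 newforms are the 11 listed orbits of `Levels/N4384.lean`
with the listed characteristic polynomials up to sign** (computed hypotheses `DataComplete`, `RefinesCPSymAll`; base primes `≥ 17`: [29] ⊆ `R₃₂(137)` = [2, 5, 29] (level raising, excluded by the slice hypothesis; `decide`)). -/
theorem CONJ_LR32_L2At_137 (M : NewformModel) (hD : M.DataComplete 4384 level4384Orbits) (hCP : M.RefinesCPSymAll 4384 level4384CP) :
    CONJ_LR32_L2At M 137 :=
  CONJ_LR32_L2At_of_not_arisesMod M (by norm_num) fun n hn h17 hnℓ hLR f hA => by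
    obtain ⟨o, ho, hfo⟩ := hD f
    simp only [level4384Orbits, List.mem_cons, List.not_mem_nil, or_false] at ho
    rcases ho with rfl | rfl | rfl | rfl | rfl | rfl | rfl | rfl | rfl | rfl | rfl
    · exact not_arisesMod_of_cpCheck_lr M a32_val_137 _ _ _ cp_4384_1_check (by norm_num) (hCP.of_mem (by simp [level4384CP])) hn h17 hnℓ hLR
        (by decide +kernel) f hfo hA
    · exact not_arisesMod_of_cpCheck_lr M a32_val_137 _ _ _ cp_4384_2_check (by norm_num) (hCP.of_mem (by simp [level4384CP])) hn h17 hnℓ hLR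
        (by decide +kernel) f hfo hA
    · exact not_arisesMod_of_cpCheck_lr M a32_val_137 _ _ _ cp_4384_3_check (by norm_num) (hCP.of_mem (by simp [level4384CP])) hn h17 hnℓ hLR
        (by decide +kernel) f hfo hA
    · exact not_arisesMod_of_cpCheck_lr M a32_val_137 _ _ _ cp_4384_4_check (by norm_num) (hCP.of_mem (by simp [level4384CP])) hn h17 hnℓ hLR
        (by decide +kernel) f hfo hA
    · exact not_arisesMod_of_cpCheck_lr M a32_val_137 _ _ _ cp_4384_5_check (by norm_num) (hCP.of_mem (by simp [level4384CP])) hn h17 hnℓ hLR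
        (by decide +kernel) f hfo hA
    · exact not_arisesMod_of_cpCheck_lr M a32_val_137 _ _ _ cp_4384_6_check (by norm_num) (hCP.of_mem (by simp [level4384CP])) hn h17 hnℓ hLR
        (by decide +kernel) f hfo hA
    · exact not_arisesMod_of_cpCheck_lr M a32_val_137 _ _ _ cp_4384_7_check (by norm_num) (hCP.of_mem (by simp [level4384CP])) hn h17 hnℓ hLR
        (by decide +kernel) f hfo hA
    · exact not_arisesMod_of_cpCheck_lr M a32_val_137 _ _ _ cp_4384_8_check (by norm_num) (hCP.of_mem (by simp [level4384CP])) hn h17 hnℓ hLR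
        (by decide +kernel) f hfo hA
    · exact not_arisesMod_of_cpCheck_lr M a32_val_137 _ _ _ cp_4384_9_check (by norm_num) (hCP.of_mem (by simp [level4384CP])) hn h17 hnℓ hLR
        (by decide +kernel) f hfo hA
    · exact not_arisesMod_of_cpCheck_lr M a32_val_137 _ _ _ cp_4384_10_check (by norm_num) (hCP.of_mem (by simp [level4384CP])) hn h17 hnℓ hLR
        (by decide +kernel) f hfo hA
    · exact not_arisesMod_of_cpCheck_lr M a32_val_137 _ _ _ cp_4384_11_check (by norm_num) (hCP.of_mem (by simp [level4384CP])) hn h17 hnℓ hLR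
        (by decide +kernel) f hfo hA

/-- `a_{151}(32a) = 0` (naive point count on `y² = x³ − x`, the tree's `a32`; evaluated ONCE here so that the slice below does not
recompute it per orbit). -/
theorem a32_val_151 : a32 151 = 0 := by decide +kernel

/-- **`CONJ_LR32_L2` at `ℓ = 151` (level `4832 = 2⁵·151`) holds in every model whose level-4832 newforms are the 12 listed orbits of `Levels/N4832.lean`
with the listed characteristic polynomials up to sign** (computed hypotheses `DataComplete`, `RefinesCPSymAll`; base primes `≥ 17`: [19] ⊆ `R₃₂(151)` = [2, 19] (level raising, excluded by the slice hypothesis; `decide`)). -/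
theorem CONJ_LR32_L2At_151 (M : NewformModel) (hD : M.DataComplete 4832 level4832Orbits) (hCP : M.RefinesCPSymAll 4832 level4832CP) :
    CONJ_LR32_L2At M 151 :=
  CONJ_LR32_L2At_of_not_arisesMod M (by norm_num) fun n hn h17 hnℓ hLR f hA => by
    obtain ⟨o, ho, hfo⟩ := hD f
    simp only [level4832Orbits, List.mem_cons, List.not_mem_nil, or_false] at ho
    rcases ho with rfl | rfl | rfl | rfl | rfl | rfl | rfl | rfl | rfl | rfl | rfl | rfl
    · exact not_arisesMod_of_cpCheck_lr M a32_val_151 _ _ _ cp_4832_1_check (by norm_num) (hCP.of_mem (by simp [level4832CP])) hn h17 hnℓ hLR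
        (by decide +kernel) f hfo hA
    · exact not_arisesMod_of_cpCheck_lr M a32_val_151 _ _ _ cp_4832_2_check (by norm_num) (hCP.of_mem (by simp [level4832CP])) hn h17 hnℓ hLR
        (by decide +kernel) f hfo hA
    · exact not_arisesMod_of_cpCheck_lr M a32_val_151 _ _ _ cp_4832_3_check (by norm_num) (hCP.of_mem (by simp [level4832CP])) hn h17 hnℓ hLR
        (by decide +kernel) f hfo hA
    · exact not_arisesMod_of_cpCheck_lr M a32_val_151 _ _ _ cp_4832_4_check (by norm_num) (hCP.of_mem (by simp [level4832CP])) hn h17 hnℓ hLR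
        (by decide +kernel) f hfo hA
    · exact not_arisesMod_of_cpCheck_lr M a32_val_151 _ _ _ cp_4832_5_check (by norm_num) (hCP.of_mem (by simp [level4832CP])) hn h17 hnℓ hLR
        (by decide +kernel) f hfo hA
    · exact not_arisesMod_of_cpCheck_lr M a32_val_151 _ _ _ cp_4832_6_check (by norm_num) (hCP.of_mem (by simp [level4832CP])) hn h17 hnℓ hLR
        (by decide +kernel) f hfo hA
    · exact not_arisesMod_of_cpCheck_lr M a32_val_151 _ _ _ cp_4832_7_check (by norm_num) (hCP.of_mem (by simp [level4832CP])) hn h17 hnℓ hLR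
        (by decide +kernel) f hfo hA
    · exact not_arisesMod_of_cpCheck_lr M a32_val_151 _ _ _ cp_4832_8_check (by norm_num) (hCP.of_mem (by simp [level4832CP])) hn h17 hnℓ hLR
        (by decide +kernel) f hfo hA
    · exact not_arisesMod_of_cpCheck_lr M a32_val_151 _ _ _ cp_4832_9_check (by norm_num) (hCP.of_mem (by simp [level4832CP])) hn h17 hnℓ hLR
        (by decide +kernel) f hfo hA
    · exact not_arisesMod_of_cpCheck_lr M a32_val_151 _ _ _ cp_4832_10_check (by norm_num) (hCP.of_mem (by simp [level4832CP])) hn h17 hnℓ hLR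
        (by decide +kernel) f hfo hA
    · exact not_arisesMod_of_cpCheck_lr M a32_val_151 _ _ _ cp_4832_11_check (by norm_num) (hCP.of_mem (by simp [level4832CP])) hn h17 hnℓ hLR
        (by decide +kernel) f hfo hA
    · exact not_arisesMod_of_cpCheck_lr M a32_val_151 _ _ _ cp_4832_12_check (by norm_num) (hCP.of_mem (by simp [level4832CP])) hn h17 hnℓ hLR
        (by decide +kernel) f hfo hA

/-- **`CONJ_LR32_L2` at `ℓ = 199` (level `6368 = 2⁵·199`) holds in every model whose level-6368 newforms are the 14 listed orbits of `Levels/N6368.lean`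
with the listed characteristic polynomials up to sign** (computed hypotheses `DataComplete`, `RefinesCPSymAll`; vacuous: every certificate base prime is `< 17`). -/
theorem CONJ_LR32_L2At_199 (M : NewformModel) (hD : M.DataComplete 6368 level6368Orbits) (hCP : M.RefinesCPSymAll 6368 level6368CP) :
    CONJ_LR32_L2At M 199 :=
  CONJ_LR32_L2At_of_not_arisesMod M (by norm_num) fun n hn h17 hnℓ hLR f hA => by
    obtain ⟨o, ho, hfo⟩ := hD f
    simp only [level6368Orbits, List.mem_cons, List.not_mem_nil, or_false] at ho
    rcases ho with rfl | rfl | rfl | rfl | rfl | rfl | rfl | rfl | rfl | rfl | rfl | rfl | rfl | rfl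
    · exact not_arisesMod_of_cpCheck_lr M rfl _ _ _ cp_6368_1_check (by norm_num) (hCP.of_mem (by simp [level6368CP])) hn h17 hnℓ hLR
        (by decide +kernel) f hfo hA
    · exact not_arisesMod_of_cpCheck_lr M rfl _ _ _ cp_6368_2_check (by norm_num) (hCP.of_mem (by simp [level6368CP])) hn h17 hnℓ hLR
        (by decide +kernel) f hfo hA
    · exact not_arisesMod_of_cpCheck_lr M rfl _ _ _ cp_6368_3_check (by norm_num) (hCP.of_mem (by simp [level6368CP])) hn h17 hnℓ hLR
        (by decide +kernel) f hfo hA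
    · exact not_arisesMod_of_cpCheck_lr M rfl _ _ _ cp_6368_4_check (by norm_num) (hCP.of_mem (by simp [level6368CP])) hn h17 hnℓ hLR
        (by decide +kernel) f hfo hA
    · exact not_arisesMod_of_cpCheck_lr M rfl _ _ _ cp_6368_5_check (by norm_num) (hCP.of_mem (by simp [level6368CP])) hn h17 hnℓ hLR
        (by decide +kernel) f hfo hA
    · exact not_arisesMod_of_cpCheck_lr M rfl _ _ _ cp_6368_6_check (by norm_num) (hCP.of_mem (by simp [level6368CP])) hn h17 hnℓ hLR
        (by decide +kernel) f hfo hA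
    · exact not_arisesMod_of_cpCheck_lr M rfl _ _ _ cp_6368_7_check (by norm_num) (hCP.of_mem (by simp [level6368CP])) hn h17 hnℓ hLR
        (by decide +kernel) f hfo hA
    · exact not_arisesMod_of_cpCheck_lr M rfl _ _ _ cp_6368_8_check (by norm_num) (hCP.of_mem (by simp [level6368CP])) hn h17 hnℓ hLR
        (by decide +kernel) f hfo hA
    · exact not_arisesMod_of_cpCheck_lr M rfl _ _ _ cp_6368_9_check (by norm_num) (hCP.of_mem (by simp [level6368CP])) hn h17 hnℓ hLR
        (by decide +kernel) f hfo hA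
    · exact not_arisesMod_of_cpCheck_lr M rfl _ _ _ cp_6368_10_check (by norm_num) (hCP.of_mem (by simp [level6368CP])) hn h17 hnℓ hLR
        (by decide +kernel) f hfo hA
    · exact not_arisesMod_of_cpCheck_lr M rfl _ _ _ cp_6368_11_check (by norm_num) (hCP.of_mem (by simp [level6368CP])) hn h17 hnℓ hLR
        (by decide +kernel) f hfo hA
    · exact not_arisesMod_of_cpCheck_lr M rfl _ _ _ cp_6368_12_check (by norm_num) (hCP.of_mem (by simp [level6368CP])) hn h17 hnℓ hLR
        (by decide +kernel) f hfo hA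
    · exact not_arisesMod_of_cpCheck_lr M rfl _ _ _ cp_6368_13_check (by norm_num) (hCP.of_mem (by simp [level6368CP])) hn h17 hnℓ hLR
        (by decide +kernel) f hfo hA
    · exact not_arisesMod_of_cpCheck_lr M rfl _ _ _ cp_6368_14_check (by norm_num) (hCP.of_mem (by simp [level6368CP])) hn h17 hnℓ hLR
        (by decide +kernel) f hfo hA

/-- **`CONJ_LR32_L2` at `ℓ = 223` (level `7136 = 2⁵·223`) holds in every model whose level-7136 newforms are the 12 listed orbits of `Levels/N7136.lean`
with the listed characteristic polynomials up to sign** (computed hypotheses `DataComplete`, `RefinesCPSymAll`; vacuous: every certificate base prime is `< 17`). -/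
theorem CONJ_LR32_L2At_223 (M : NewformModel) (hD : M.DataComplete 7136 level7136Orbits) (hCP : M.RefinesCPSymAll 7136 level7136CP) :
    CONJ_LR32_L2At M 223 :=
  CONJ_LR32_L2At_of_not_arisesMod M (by norm_num) fun n hn h17 hnℓ hLR f hA => by
    obtain ⟨o, ho, hfo⟩ := hD f
    simp only [level7136Orbits, List.mem_cons, List.not_mem_nil, or_false] at ho
    rcases ho with rfl | rfl | rfl | rfl | rfl | rfl | rfl | rfl | rfl | rfl | rfl | rfl
    · exact not_arisesMod_of_cpCheck_lr M rfl _ _ _ cp_7136_1_check (by norm_num) (hCP.of_mem (by simp [level7136CP])) hn h17 hnℓ hLR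
        (by decide +kernel) f hfo hA
    · exact not_arisesMod_of_cpCheck_lr M rfl _ _ _ cp_7136_2_check (by norm_num) (hCP.of_mem (by simp [level7136CP])) hn h17 hnℓ hLR
        (by decide +kernel) f hfo hA
    · exact not_arisesMod_of_cpCheck_lr M rfl _ _ _ cp_7136_3_check (by norm_num) (hCP.of_mem (by simp [level7136CP])) hn h17 hnℓ hLR
        (by decide +kernel) f hfo hA
    · exact not_arisesMod_of_cpCheck_lr M rfl _ _ _ cp_7136_4_check (by norm_num) (hCP.of_mem (by simp [level7136CP])) hn h17 hnℓ hLR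
        (by decide +kernel) f hfo hA
    · exact not_arisesMod_of_cpCheck_lr M rfl _ _ _ cp_7136_5_check (by norm_num) (hCP.of_mem (by simp [level7136CP])) hn h17 hnℓ hLR
        (by decide +kernel) f hfo hA
    · exact not_arisesMod_of_cpCheck_lr M rfl _ _ _ cp_7136_6_check (by norm_num) (hCP.of_mem (by simp [level7136CP])) hn h17 hnℓ hLR
        (by decide +kernel) f hfo hA
    · exact not_arisesMod_of_cpCheck_lr M rfl _ _ _ cp_7136_7_check (by norm_num) (hCP.of_mem (by simp [level7136CP])) hn h17 hnℓ hLR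
        (by decide +kernel) f hfo hA
    · exact not_arisesMod_of_cpCheck_lr M rfl _ _ _ cp_7136_8_check (by norm_num) (hCP.of_mem (by simp [level7136CP])) hn h17 hnℓ hLR
        (by decide +kernel) f hfo hA
    · exact not_arisesMod_of_cpCheck_lr M rfl _ _ _ cp_7136_9_check (by norm_num) (hCP.of_mem (by simp [level7136CP])) hn h17 hnℓ hLR
        (by decide +kernel) f hfo hA
    · exact not_arisesMod_of_cpCheck_lr M rfl _ _ _ cp_7136_10_check (by norm_num) (hCP.of_mem (by simp [level7136CP])) hn h17 hnℓ hLR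
        (by decide +kernel) f hfo hA
    · exact not_arisesMod_of_cpCheck_lr M rfl _ _ _ cp_7136_11_check (by norm_num) (hCP.of_mem (by simp [level7136CP])) hn h17 hnℓ hLR
        (by decide +kernel) f hfo hA
    · exact not_arisesMod_of_cpCheck_lr M rfl _ _ _ cp_7136_12_check (by norm_num) (hCP.of_mem (by simp [level7136CP])) hn h17 hnℓ hLR
        (by decide +kernel) f hfo hA

end Summit.Ventures.AbcSig.Conjectures
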